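import Summits.BirchSwinnertonDyer.BirchSwinnertonDyer.Theorems.PrintCFramBottomClassIndexLawFiveLeBorelKernelCebotarev
import Summits.BirchSwinnertonDyer.BirchSwinnertonDyer.Theorems.PrintCFramBottomClassIndexLawFiveLeBorelKolyvaginVisibility
import Summits.BirchSwinnertonDyer.BirchSwinnertonDyer.Theorems.PrintCFramBottomClassIndexLawFiveLeBorelMcCallumProp31
import HarnessLib

/-!
# Route `PrintCFram`, crux C2 `BottomClassIndexLawFiveLe` (stmt-BirchSwinnertonDyer-20372), line
# `eisenstein-resource-bdp-line` (stub `stub_kolyvaginUpper_borelCM_pairSum_offKrizLi`, input (γ)):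
# **WHAT THE MACHINE CAN PRESCRIBE AT THE BOREL PRIME** — eigen targets of every admissible
# `𝓞`-depth, order ↔ depth, and McCallum's Cor. 3.2 WITH PRESCRIBED LOCAL ORDERS for families of
# eigenclasses (the positive half of the visibility analysis)
# (cell `bsd-print-cfram`, seat `bsd-line-cfram-p1-w2` g6; helper `--supports` 20372; 0 facts, 0 defs)

HONEST FRAMING. Nothing about BSD is proved here, and nothing of the stub itself. The descent
`KolyvaginDescent.HypothesesM` consumes Kolyvagin primes at which finitely many `τ`-eigenclasses
`c_i` have PRESCRIBED local orders `p^{N_i}` (McCallum Cor. 3.2). At the Borel CM-ramified prime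
FILE 1 (`exists_kolyvaginPrime_gt_pow_kernel_of_cmRamified`) realises any same-sign eigen TARGETS
`t_i ∈ W[𝔭^{e_i}]`; what local orders that buys is a question about the layers `W[𝔭^d]`:
* GRADED SIGN (`pow_apply_smul_of_anti`, `pow_sub_one_apply_smul_sub_eq_zero`): `μ = √−p`
  anti-commutes with complex conjugation `c₀`, so `c₀` acts on the `d`-th graded piece
  `W[𝔭^d]/W[𝔭^{d−1}]` by the sign `η_line·(−1)^{d−1}` (`η_line` = the sign on `W[𝔭]`,
  `exists_lineSign_of_isComplexConjugation`): for `t ∈ W[𝔭^d]`, `μ^{d−1}(c₀ t − (−1)^{d−1}η t) = 0`;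
* EIGEN TARGETS OF EXACT DEPTH (`exists_eigen_exactDepth`): for every `t₀` of exact depth `d` and
  `ν = (−1)^{d−1}η_line`, `t₀ + ν c₀ t₀` is a `ν`-eigenvector of EXACT depth `d`; hence a
  `ν`-eigenvector of exact depth `d` exists iff `d` has the parity dictated by `ν`
  (sign `η_line` ↔ odd depths, sign `−η_line` ↔ even depths);
* ORDER ↔ DEPTH (`pow_zsmul_eq_zero_iff_pow_two_mul_apply_eq_zero`): `p^a t = 0 ⟺ μ^{2a} t = 0`,
  so exact depth `d` means order `p^{⌈d/2⌉}`;
* COR. 3.2 WITH ORDERS AT THE BOREL PRIME (`exists_kolyvaginPrime_gt_pow_orders_of_cmRamified`): for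
  `c_*`-eigenclasses `x_i` with exact `𝓞`-depths `e_i` (independent top layers) and requested
  depths `1 ≤ d_i ≤ e_i` of the parity of `ν_i` (`ν_i = (−1)^{d_i−1}η_line`), a Kolyvagin prime
  `ℓ > b` with **`ord (x_i)_λ = p^{⌈d_i/2⌉}` exactly** (`p^{N_i}x_i ∈ ker loc_λ`,
  `p^{N_i−1}x_i ∉ ker loc_λ`). So: sign `η_line` ⟹ EVERY order up to its own is prescribable
  (odd `d_i ≤ e_i`); sign `−η_line` ⟹ orders up to `p^{⌊e_i/2⌋}` (even `d_i ≤ e_i`) — the full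
  order iff `e_i` is even, one step short iff odd, nothing iff `e_i = 1` (the blind classes of
  FILES 3–5). This is the exact input a Borel-adapted descent has at its disposal.
THEOREMS ONLY; no definition, no named fact, no `sorry`. BSD is not proved by any of this; no
summit statement is proved by this seat. References: [McCallumLMS1991] §3 Cor. 3.2; [GrossLMS1991] §9.
-/

set_option autoImplicit false
-- `…BirchSwinnertonDyer.BirchSwinnertonDyer.Theorems…` is the problem's mandated namespace (D-0017).
set_option linter.dupNamespace false

noncomputable section

open scoped Classical

namespace Summit.BirchSwinnertonDyer.BirchSwinnertonDyer.Theorems.PrintCFram.BorelKolyvaginPairing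

open WeierstrassCurve NumberField IsDedekindDomain Field Literature.NumberTheory.EllipticCurves
  Literature.NumberTheory.GaloisRepresentations Literature.NumberTheory.EllipticCurves.Rank1Residual
  Summit.BirchSwinnertonDyer.BirchSwinnertonDyer.Theorems.PrintCFram.BorelHomothety

/-! ## §1 Graded sign, order ↔ depth, eigen targets of exact depth (`ℚ̄`-side) -/

section Graded

variable (W : WeierstrassCurve ℚ) [W.IsElliptic] (p : ℕ) [hp : Fact p.Prime]

omit [W.IsElliptic] in
/-- **`μ^k (c₀ P) = (−1)^k c₀ μ^k(P)`** for a complex conjugation `c₀` and `μ = √−p` with its sign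
rule. [cite: Rubin1999, Cor. 5.5] -/
theorem pow_apply_smul_of_anti {c₀ : absoluteGaloisGroup ℚ}
    (hc₀ : IsComplexConjugation (Rat.castHom ℝ) c₀) {s : AlgebraicClosure ℚ}
    {μ : AddMonoid.End W.geomPoints} (hs : s ^ 2 = ((-(p : ℤ) : ℤ) : AlgebraicClosure ℚ))
    (hanti : ∀ g : absoluteGaloisGroup ℚ, g • s = -s → ∀ P, μ (g • P) = -(g • μ P))
    (k : ℕ) (P : W.geomPoints) : (μ ^ k) (c₀ • P) = ((-1 : ℤ) ^ k) • (c₀ • (μ ^ k) P) := by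
  induction k generalizing P with
  | zero => simp
  | succ k ih =>
    rw [pow_succ_apply, pow_succ_apply, ih, map_zsmul,
      apply_smul_eq_neg_of_isComplexConjugation p hc₀ hs hanti ((μ ^ k) P), pow_succ, ← smul_smul,
      neg_one_zsmul]

omit [W.IsElliptic] in
/-- **The graded sign.** If `c₀` acts on the line `ker μ` by `η` and `μ^d t = 0` (`d ≥ 1`), then
`μ^{d−1}(c₀ t − ((−1)^{d−1}η) t) = 0`: complex conjugation acts on `W[𝔭^d]/W[𝔭^{d−1}]` by the sign
`η·(−1)^{d−1}`. [folklore] -/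
theorem pow_sub_one_apply_smul_sub_eq_zero {c₀ : absoluteGaloisGroup ℚ}
    (hc₀ : IsComplexConjugation (Rat.castHom ℝ) c₀) {s : AlgebraicClosure ℚ}
    {μ : AddMonoid.End W.geomPoints} (hs : s ^ 2 = ((-(p : ℤ) : ℤ) : AlgebraicClosure ℚ))
    (hanti : ∀ g : absoluteGaloisGroup ℚ, g • s = -s → ∀ P, μ (g • P) = -(g • μ P)) {η : ℤ}
    (hη : ∀ P : W.geomPoints, μ P = 0 → c₀ • P = η • P) {d : ℕ} (hd : 1 ≤ d) {t : W.geomPoints}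
    (ht : (μ ^ d) t = 0) :
    (μ ^ (d - 1)) (c₀ • t - (((-1 : ℤ) ^ (d - 1) * η) • t)) = 0 := by
  have hker : μ ((μ ^ (d - 1)) t) = 0 := by
    rw [← pow_succ_apply, Nat.sub_add_cancel hd, ht]
  rw [map_sub, pow_apply_smul_of_anti W p hc₀ hs hanti, hη _ hker, map_zsmul, smul_smul, sub_self]

omit [W.IsElliptic] hp in
/-- **Order ↔ depth**: `p^a t = 0 ⟺ μ^{2a} t = 0` (`μ² = [m]`, `|m| = p`). [folklore] -/
theorem pow_zsmul_eq_zero_iff_pow_two_mul_apply_eq_zero {μ : AddMonoid.End W.geomPoints} {m : ℤ}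
    (hm : m.natAbs = p) (hμμ : ∀ P, μ (μ P) = m • P) (a : ℕ) (t : W.geomPoints) :
    ((p : ℤ) ^ a) • t = 0 ↔ (μ ^ (2 * a)) t = 0 := by
  rw [pow_two_mul_apply W hμμ a t]
  rcases Int.natAbs_eq m with h | h
  · rw [← hm, ← h]
  · rw [show m ^ a = (-1) ^ a * (p : ℤ) ^ a by rw [← mul_pow, ← hm]; congr 1; omega, mul_smul]
    rcases neg_one_pow_eq_or ℤ a with h1 | h1
    · rw [h1, one_smul]
    · rw [h1, neg_one_zsmul, neg_eq_zero]

omit [W.IsElliptic] hp in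
/-- Exact depth is monotone: `μ^d t = 0`, `μ^{d−1} t ≠ 0` ⟹ (`μ^k t = 0 ⟺ d ≤ k`). [folklore] -/
theorem pow_apply_eq_zero_iff_le {μ : AddMonoid.End W.geomPoints} {d : ℕ} {t : W.geomPoints}
    (ht : (μ ^ d) t = 0) (ht' : d = 0 ∨ (μ ^ (d - 1)) t ≠ 0) (k : ℕ) :
    (μ ^ k) t = 0 ↔ d ≤ k := by
  constructor
  · intro hk
    by_contra hlt
    push Not at hlt
    rcases ht' with h0 | hne
    · omega
    · apply hne
      obtain ⟨j, hj⟩ := Nat.exists_eq_add_of_le (Nat.le_sub_one_of_lt hlt)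
      rw [hj, add_comm, pow_add, AddMonoid.End.coe_mul, Function.comp_apply, hk, map_zero]
  · intro hdk
    obtain ⟨j, rfl⟩ := Nat.exists_eq_add_of_le hdk
    rw [add_comm, pow_add, AddMonoid.End.coe_mul, Function.comp_apply, ht, map_zero]

omit [W.IsElliptic] hp in
/-- **Order of a vector of exact depth `d`**: `p^a t = 0 ⟺ d ≤ 2a`, i.e. `ord t = p^{⌈d/2⌉}`. [folklore] -/
theorem pow_zsmul_eq_zero_iff_le_two_mul {μ : AddMonoid.End W.geomPoints} {m : ℤ}
    (hm : m.natAbs = p) (hμμ : ∀ P, μ (μ P) = m • P) {d : ℕ} {t : W.geomPoints}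
    (ht : (μ ^ d) t = 0) (ht' : d = 0 ∨ (μ ^ (d - 1)) t ≠ 0) (a : ℕ) :
    ((p : ℤ) ^ a) • t = 0 ↔ d ≤ 2 * a := by
  rw [pow_zsmul_eq_zero_iff_pow_two_mul_apply_eq_zero W p hm hμμ, pow_apply_eq_zero_iff_le W ht ht']

omit [W.IsElliptic] hp in
/-- `μ^k` preserves `W[n]`. [folklore] -/
theorem pow_apply_mem_geomTorsion {μ : AddMonoid.End W.geomPoints} {n : ℤ} (k : ℕ)
    {P : W.geomPoints} (hP : P ∈ W.geomTorsion n) : (μ ^ k) P ∈ W.geomTorsion n := by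
  induction k with
  | zero => simpa using hP
  | succ k ih => rw [pow_succ_apply]; exact apply_mem_geomTorsion W ih

omit [W.IsElliptic] in
/-- **Eigen targets of exact depth.** From any `t₀ ∈ W(ℚ̄)[p^M]` of exact depth `d ≥ 1`
(`μ^d t₀ = 0`, `μ^{d−1} t₀ ≠ 0`) and the sign `ν = (−1)^{d−1}η` (`η` the sign of `c₀` on `ker μ`),
the vector `t = t₀ + ν c₀ t₀ ∈ W(ℚ̄)[p^M]` is a `ν`-EIGENVECTOR of `c₀` of EXACT depth `d`
(`μ^{d−1} t = 2 μ^{d−1} t₀ ≠ 0`, `p` odd). So `ν`-eigen targets of exact depth `d` exist for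
`ν = η` and `d` odd, and for `ν = −η` and `d` even. [cite: McCallumLMS1991, §3 (E^±)] -/
theorem exists_eigen_exactDepth {c₀ : absoluteGaloisGroup ℚ}
    (hc₀ : IsComplexConjugation (Rat.castHom ℝ) c₀) {s : AlgebraicClosure ℚ}
    {μ : AddMonoid.End W.geomPoints} (hs : s ^ 2 = ((-(p : ℤ) : ℤ) : AlgebraicClosure ℚ))
    (hanti : ∀ g : absoluteGaloisGroup ℚ, g • s = -s → ∀ P, μ (g • P) = -(g • μ P))
    (hp2 : p ≠ 2) {η : ℤ} (hηs : η = 1 ∨ η = -1)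
    (hη : ∀ P : W.geomPoints, μ P = 0 → c₀ • P = η • P) {M d : ℕ} (hd : 1 ≤ d)
    {t₀ : W.geomPoints} (ht₀M : t₀ ∈ W.geomTorsion ((p ^ M : ℕ) : ℤ))
    (ht₀ : (μ ^ d) t₀ = 0) (ht₀' : (μ ^ (d - 1)) t₀ ≠ 0) :
    ∃ t : W.geomPoints, t ∈ W.geomTorsion ((p ^ M : ℕ) : ℤ) ∧
      c₀ • t = (((-1 : ℤ) ^ (d - 1) * η)) • t ∧ (μ ^ d) t = 0 ∧ (μ ^ (d - 1)) t ≠ 0 := by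
  set ν : ℤ := (-1 : ℤ) ^ (d - 1) * η with hν
  have hνν : ν * ν = 1 := by
    rw [hν]
    rcases neg_one_pow_eq_or ℤ (d - 1) with h | h <;> rcases hηs with h' | h' <;> simp [h, h']
  have hc₀t₀ : c₀ • t₀ ∈ W.geomTorsion ((p ^ M : ℕ) : ℤ) :=
    (c₀ • (⟨t₀, ht₀M⟩ : W.geomTorsion ((p ^ M : ℕ) : ℤ))).2
  refine ⟨t₀ + ν • (c₀ • t₀), add_mem ht₀M (AddSubgroup.zsmul_mem _ hc₀t₀ ν), ?_, ?_, ?_⟩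
  · -- eigen: `c₀ (t₀ + ν c₀ t₀) = c₀ t₀ + ν t₀ = ν (t₀ + ν c₀ t₀)`
    rw [smul_add, smul_comm c₀ ν, smul_smul c₀ c₀, ← pow_two, hc₀.sq_eq_one, one_smul, smul_add,
      smul_smul ν ν, hνν, one_smul, add_comm]
  · -- depth ≤ d
    rw [map_add, map_zsmul, pow_apply_smul_of_anti W p hc₀ hs hanti, ht₀, smul_zero, smul_zero,
      smul_zero, add_zero]
  · -- exact depth d: `μ^{d-1}(t₀ + ν c₀ t₀) = (1 + ν ν) μ^{d-1} t₀ = 2 μ^{d-1} t₀`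
    have hgr := pow_sub_one_apply_smul_sub_eq_zero W p hc₀ hs hanti hη hd ht₀
    rw [map_sub, sub_eq_zero, map_zsmul] at hgr
    rw [map_add, map_zsmul, hgr, smul_smul, hνν, one_smul, ← two_zsmul]
    -- `2 • μ^{d-1} t₀ ≠ 0` on the `p`-power torsion, `p` odd
    intro h2
    apply ht₀'
    have hmem : (μ ^ (d - 1)) t₀ ∈ W.geomTorsion ((p ^ M : ℕ) : ℤ) :=
      pow_apply_mem_geomTorsion W (d - 1) ht₀M
    obtain ⟨u, hu⟩ := exists_two_mul_zsmul_eq_of_odd W (n := p ^ M)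
      ((hp.out.odd_of_ne_two hp2).pow)
    have h1 := hu ⟨_, hmem⟩
    rw [mul_comm, mul_zsmul] at h1
    have h2' : (2 : ℤ) • (⟨(μ ^ (d - 1)) t₀, hmem⟩ : W.geomTorsion ((p ^ M : ℕ) : ℤ)) = 0 :=
      Subtype.ext (by rw [AddSubgroupClass.coe_zsmul, ZeroMemClass.coe_zero]; exact h2)
    rw [h2', zsmul_zero] at h1
    exact (congrArg Subtype.val h1.symm).trans (ZeroMemClass.coe_zero _)

end Graded

/-! ## §2 McCallum's Cor. 3.2 WITH PRESCRIBED LOCAL ORDERS at the Borel prime -/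

section Orders

variable (W : WeierstrassCurve ℚ) [W.IsElliptic] (p : ℕ) [hp : Fact p.Prime]
variable {K : Type} [Field K] [NumberField K]

/-- **McCallum 1991, Cor. 3.2 WITH PRESCRIBED LOCAL ORDERS at the Borel CM-ramified prime.** `W` CM,
`5 ≤ p` CM-ramified, `𝓞_𝔭`-structure `(s, μ, m)` with both sign rules; `K` imaginary quadratic with
complex conjugation `c` lifted along `c₀`; `η = ±1` the sign of `c₀` on `ker μ = W[𝔭]`
(`exists_lineSign_of_isComplexConjugation`); `M ≥ 1`; `c_*`-eigenclasses `x_i ∈ H¹(K, W[p^M])` of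
signs `ν_i` with EXACT `𝓞`-depths `e_i` (`μ^{e_i}` kills every value, the top-layer functionals
`∑ c_i μ^{e_i−1}[x_i, ·]` are independent — the hypotheses of `exists_h1Eval_eq_pow_of_cmRamified`);
requested depths `1 ≤ d_i ≤ e_i` OF THE PARITY OF THE SIGN, `ν_i = (−1)^{d_i−1} η`. Then above every
`b` there is a Kolyvagin prime `ℓ` of level `p^M` (`ℓ ∤ N d_K p`, `(ℓ)` prime, `Frob(ℓ) = Frob(∞)`
on `K(W_{p^M})`) at whose place **`ord (x_i)_λ = p^{⌈d_i/2⌉}` exactly**: `p^{N_i} x_i ∈ ker loc_λ`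
and `p^{N_i−1} x_i ∉ ker loc_λ`, `N_i = ⌈d_i/2⌉` — the shape of `KolyvaginDescent.HypothesesM.cebotarev`.
Consequently classes of sign `η` admit EVERY order up to their own (`d_i` odd `≤ e_i`), classes of
sign `−η` admit orders up to `p^{⌊e_i/2⌋}` (`d_i` even `≤ e_i`). Proof: targets `t_i` = `ν_i`-eigen
vectors of exact depth `d_i` built from a top value of `x_i` (`exists_eigen_exactDepth`), realised by
FILE 1's kernel-form Čebotarev; `ord = p^{⌈depth/2⌉}`. [cite: McCallumLMS1991, §3 Cor. 3.2] -/
theorem exists_kolyvaginPrime_gt_pow_orders_of_cmRamified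
    (hC : Literature.NumberTheory.Automorphic.chebotarev_artinRep) {N : ℕ} [NeZero N]
    (hCM : W.HasCM) (h5 : 5 ≤ p) (hram : CMRamified W p)
    {s : AlgebraicClosure ℚ} {μ : AddMonoid.End W.geomPoints} {m : ℤ}
    (hs : s ^ 2 = ((-(p : ℤ) : ℤ) : AlgebraicClosure ℚ)) (hm : m.natAbs = p)
    (hμμ : ∀ P, μ (μ P) = m • P)
    (hcomm : ∀ g : absoluteGaloisGroup ℚ, g • s = s → ∀ P, μ (g • P) = g • μ P)
    (hanti : ∀ g : absoluteGaloisGroup ℚ, g • s = -s → ∀ P, μ (g • P) = -(g • μ P))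
    (hK : IsImaginaryQuadratic K) {M : ℕ} (hM : 1 ≤ M) {c : K ≃ₐ[ℚ] K}
    {c₀ : absoluteGaloisGroup ℚ} (hc₀ : IsComplexConjugation (Rat.castHom ℝ) c₀)
    (ht : IsLiftOfAut c (absGaloisTransport (K := ℚ) (L := K) c₀).toRingEquiv)
    {η : ℤ} (hηs : η = 1 ∨ η = -1) (hη : ∀ P : W.geomPoints, μ P = 0 → c₀ • P = η • P)
    {ι : Type*} [Fintype ι] (xs : ι → galH1Torsion (W.baseChange K) ((p ^ M : ℕ) : ℤ))
    {ν : ι → ℤ} (hxs : ∀ i, conjAct W c ((p ^ M : ℕ) : ℤ) (xs i) = ν i • xs i) (e : ι → ℕ)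
    (he : ∀ i, ∀ ρ ∈ torsionFixing (W.baseChange K) ((p ^ M : ℕ) : ℤ),
      (μ ^ e i) ((RatClosure.torsionEquiv (K := K) W ((p ^ M : ℕ) : ℤ)).symm
        (h1Eval (W.baseChange K) ((p ^ M : ℕ) : ℤ) (xs i) ρ) : W.geomPoints) = 0)
    (hind : ∀ c : ι → ℤ,
      (∀ ρ ∈ torsionFixing (W.baseChange K) ((p ^ M : ℕ) : ℤ),
        ∑ i, c i • (μ ^ (e i - 1)) ((RatClosure.torsionEquiv (K := K) W ((p ^ M : ℕ) : ℤ)).symm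
          (h1Eval (W.baseChange K) ((p ^ M : ℕ) : ℤ) (xs i) ρ) : W.geomPoints) = 0) →
        ∀ i, 0 < e i → (p : ℤ) ∣ c i)
    (d : ι → ℕ) (hd : ∀ i, 1 ≤ d i ∧ d i ≤ e i) (hpar : ∀ i, ν i = (-1) ^ (d i - 1) * η) (b : ℕ) :
    ∃ ℓ : ℕ, b < ℓ ∧ ℓ.Prime ∧ ¬ ℓ ∣ N ∧ ¬ ((ℓ : ℤ) ∣ NumberField.discr K) ∧ ℓ ≠ p ∧
      (Ideal.span {(ℓ : 𝓞 K)}).IsPrime ∧ FrobEqFrobInfty W K (p ^ M) ℓ ∧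
      ∀ i, ∀ v : HeightOneSpectrum (𝓞 K), (ℓ : 𝓞 K) ∈ v.asIdeal →
        ((p : ℤ) ^ ((d i + 1) / 2)) • xs i ∈
            (W.baseChange K).torsionLocalKer (v.adicCompletion K) ((p ^ M : ℕ) : ℤ) ∧
          ((p : ℤ) ^ ((d i + 1) / 2 - 1)) • xs i ∉
            (W.baseChange K).torsionLocalKer (v.adicCompletion K) ((p ^ M : ℕ) : ℤ) := by
  have hpr : p.Prime := hp.out
  have hp2 : p ≠ 2 := by omega
  have hinv : ∀ y, (absGaloisTransport (K := ℚ) (L := K) c₀).toRingEquiv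
      ((absGaloisTransport (K := ℚ) (L := K) c₀).toRingEquiv y) = y := fun y ↦
    RatClosure.absGaloisTransport_absGaloisTransport_of_sq_eq_one hc₀.sq_eq_one y
  -- a top value for each class
  have htop : ∀ i, ∃ ρ ∈ torsionFixing (W.baseChange K) ((p ^ M : ℕ) : ℤ),
      (μ ^ (e i - 1)) (((RatClosure.torsionEquiv (K := K) W ((p ^ M : ℕ) : ℤ)).symm (h1Eval (W.baseChange K) ((p ^ M : ℕ) : ℤ) (xs i) ρ)) : W.geomPoints) ≠ 0 := by
    intro i
    by_contra hall
    push Not at hall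
    have h1 := hind (Pi.single i 1) (fun ρ hρ ↦ by
      rw [Finset.sum_eq_single i (fun j _ hj ↦ by rw [Pi.single_eq_of_ne hj, zero_smul])
        (fun h ↦ absurd (Finset.mem_univ i) h), Pi.single_eq_same, one_smul]
      exact hall ρ hρ) i (by have := hd i; omega)
    rw [Pi.single_eq_same] at h1
    exact hpr.one_lt.ne' (by exact_mod_cast Int.eq_one_of_dvd_one (Int.natCast_nonneg p) h1)
  choose ρ₀ hρ₀ hρ₀top using htop
  -- the eigen target of exact depth `d i`
  have htarget : ∀ i, ∃ t : W.geomPoints, t ∈ W.geomTorsion ((p ^ M : ℕ) : ℤ) ∧ c₀ • t = ν i • t ∧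
      (μ ^ d i) t = 0 ∧ (μ ^ (d i - 1)) t ≠ 0 := by
    intro i
    obtain ⟨hd1, hde⟩ := hd i
    have ht₀M : (μ ^ (e i - d i)) (((RatClosure.torsionEquiv (K := K) W ((p ^ M : ℕ) : ℤ)).symm (h1Eval (W.baseChange K) ((p ^ M : ℕ) : ℤ) (xs i) (ρ₀ i))) :
        W.geomPoints) ∈ W.geomTorsion ((p ^ M : ℕ) : ℤ) :=
      pow_apply_mem_geomTorsion W _ ((RatClosure.torsionEquiv (K := K) W ((p ^ M : ℕ) : ℤ)).symm (h1Eval (W.baseChange K) ((p ^ M : ℕ) : ℤ) (xs i) (ρ₀ i))).2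
    have ht₀d : (μ ^ d i) ((μ ^ (e i - d i)) (((RatClosure.torsionEquiv (K := K) W ((p ^ M : ℕ) : ℤ)).symm
        (h1Eval (W.baseChange K) ((p ^ M : ℕ) : ℤ) (xs i) (ρ₀ i))) : W.geomPoints)) = 0 := by
      change (μ ^ d i * μ ^ (e i - d i)) _ = 0
      rw [← pow_add, show d i + (e i - d i) = e i by omega]
      exact he i _ (hρ₀ i)
    have ht₀d' : (μ ^ (d i - 1)) ((μ ^ (e i - d i)) (((RatClosure.torsionEquiv (K := K) W ((p ^ M : ℕ) : ℤ)).symm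
        (h1Eval (W.baseChange K) ((p ^ M : ℕ) : ℤ) (xs i) (ρ₀ i))) : W.geomPoints)) ≠ 0 := by
      change (μ ^ (d i - 1) * μ ^ (e i - d i)) _ ≠ 0
      rw [← pow_add, show d i - 1 + (e i - d i) = e i - 1 by omega]
      exact hρ₀top i
    obtain ⟨t, htM, hteig, htd, htd'⟩ := exists_eigen_exactDepth W p hc₀ hs hanti hp2 hηs hη hd1
      ht₀M ht₀d ht₀d'
    exact ⟨t, htM, by rw [hteig, hpar i], htd, htd'⟩
  choose t htM hteig htd htd' using htarget
  -- transport the targets to `W(K̄)[p^M]`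
  let T : ι → geomTorsion (W.baseChange K) ((p ^ M : ℕ) : ℤ) := fun i ↦ (RatClosure.torsionEquiv (K := K) W ((p ^ M : ℕ) : ℤ)) ⟨t i, htM i⟩
  have hTsymm : ∀ i, (((RatClosure.torsionEquiv (K := K) W ((p ^ M : ℕ) : ℤ)).symm (T i) : W.geomTorsion ((p ^ M : ℕ) : ℤ)) : W.geomPoints) = t i := fun i ↦ by
    change (((RatClosure.torsionEquiv (K := K) W ((p ^ M : ℕ) : ℤ)).symm ((RatClosure.torsionEquiv (K := K) W ((p ^ M : ℕ) : ℤ)) ⟨t i, htM i⟩) : W.geomTorsion ((p ^ M : ℕ) : ℤ)) : W.geomPoints) = t i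
    rw [(RatClosure.torsionEquiv (K := K) W ((p ^ M : ℕ) : ℤ)).symm_apply_apply]
  have hTe : ∀ i, (μ ^ e i) (((RatClosure.torsionEquiv (K := K) W ((p ^ M : ℕ) : ℤ)).symm (T i) : W.geomTorsion ((p ^ M : ℕ) : ℤ)) : W.geomPoints) = 0 :=
    fun i ↦ by
    rw [hTsymm]
    exact (pow_apply_eq_zero_iff_le W (htd i) (Or.inr (htd' i)) (e i)).mpr (hd i).2
  have hTν : ∀ i, ht.torsionMap W ((p ^ M : ℕ) : ℤ) (T i) = ν i • T i := fun i ↦ by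
    change ht.torsionMap W ((p ^ M : ℕ) : ℤ) ((RatClosure.torsionEquiv (K := K) W ((p ^ M : ℕ) : ℤ)) ⟨t i, htM i⟩) = ν i • (RatClosure.torsionEquiv (K := K) W ((p ^ M : ℕ) : ℤ)) ⟨t i, htM i⟩
    rw [← RatClosure.torsionEquiv_smul_of_lift W ht c₀ (fun _ ↦ rfl) ((p ^ M : ℕ) : ℤ) ⟨t i, htM i⟩, ← map_zsmul]
    congr 1
    exact Subtype.ext (by
      change c₀ • t i = ((ν i • (⟨t i, htM i⟩ : W.geomTorsion ((p ^ M : ℕ) : ℤ)) : W.geomTorsion ((p ^ M : ℕ) : ℤ)) : W.geomPoints)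
      rw [AddSubgroupClass.coe_zsmul]; exact hteig i)
  -- FILE 1: the realiser and the Kolyvagin prime with kernel = kernel of `[·, ρ]`
  obtain ⟨ρ, hρT, hρt, ℓ, hbℓ, hℓ, hℓN, hℓD, hℓp, hprime, hfrob, hloc⟩ :=
    exists_kolyvaginPrime_gt_pow_kernel_of_cmRamified W p K hC (N := N) hCM h5 hram hs hm hμμ hcomm
      hK hM hc₀ ht hinv xs hxs e he hind T hTe hTν b
  refine ⟨ℓ, hbℓ, hℓ, hℓN, hℓD, hℓp, hprime, hfrob, fun i v hv ↦ ?_⟩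
  -- `(p^a x_i)_λ = 0 ⟺ p^a t_i = 0 ⟺ d_i ≤ 2a`
  have hmem : ∀ a : ℕ, ((p : ℤ) ^ a) • xs i ∈ AddSubgroup.closure (Set.range xs) := fun a ↦
    AddSubgroup.zsmul_mem _ (AddSubgroup.subset_closure (Set.mem_range_self i)) _
  have hkey : ∀ a : ℕ, ((p : ℤ) ^ a) • xs i ∈
      (W.baseChange K).torsionLocalKer (v.adicCompletion K) ((p ^ M : ℕ) : ℤ) ↔ d i ≤ 2 * a := by
    intro a
    rw [hloc _ (hmem a) v hv, h1Eval_zsmul _ _ _ _ hρT, hρt i,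
      ← pow_zsmul_eq_zero_iff_le_two_mul W p hm hμμ (htd i) (Or.inr (htd' i)) a, ← hTsymm i]
    constructor
    · intro h
      rw [← AddSubgroupClass.coe_zsmul, ← map_zsmul, h, map_zero, ZeroMemClass.coe_zero]
    · intro h
      have h' : (RatClosure.torsionEquiv (K := K) W ((p ^ M : ℕ) : ℤ)).symm (((p : ℤ) ^ a) • T i) = 0 :=
        Subtype.ext (by rw [map_zsmul, AddSubgroupClass.coe_zsmul, ZeroMemClass.coe_zero]; exact h)
      exact (AddEquiv.map_eq_zero_iff _).mp h'
  refine ⟨(hkey ((d i + 1) / 2)).mpr (by omega), fun h ↦ ?_⟩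
  have h1 := (hkey ((d i + 1) / 2 - 1)).mp h
  have h2 := (hd i).1
  omega

end Orders

end Summit.BirchSwinnertonDyer.BirchSwinnertonDyer.Theorems.PrintCFram.BorelKolyvaginPairing

end
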